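import Summits.Ventures.HSemireg.SecantParityBogomolovWindow
import Summits.Ventures.HSemireg.SecantParityObjectLevelDiagonalClasses
import HarnessLib

/-!
# Venture HSemireg — INSTANCES of the Bogomolov window (file XI) on file V-b's diagonal classes `η_s` of `E_τ^g`:
# the hypotheses `0 < hermIndex η < g` of `exists_isRiemannForm_torusIntegral_sq_wedge_neg` are inhabited at every
# `g ≥ 2` and every intermediate index — TRACK S4-PUSH (ii), seat `s4-prove-1` (g11); file XIb (for filing once XI and V-b have hub oleans)

HONEST FRAMING as in file XI. Theorems only (0 def, 0 named fact, 0 sorry). On the product of elliptic curves `E_{τ₀} × ⋯ × E_{τ_{g-1}}`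
with its product principal polarisation `θ₀ = ⊞ E_{τ_k}` (tree `IsRiemannForm.pi`) and V-b's class `η_s = -(e₀ + ⋯ + e_{s-1}) + (e_s + ⋯ + e_{g-1})`
(`hermIndex η_s = s`, non-degenerate, in `NS`), XI's window theorem applies for every `0 < s < g`: some polarisation `qθ₀ + pη_s` of the pencil has
`(η_s² · θ'^{g-2}) < 0`. Record: `s4push/prove-1/ATTEMPT-14.md` §4 (vacuity). Nothing here says HC ∕ HC_CM ∕ HC_AV holds; (S3)'s words do not move.
-/

noncomputable section

open scoped ComplexOrder
open Complex Module
open Literature.Geometry.Kaehler Literature.Geometry.Kaehler.ComplexTorus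

namespace Summit.Ventures.HSemireg

namespace SecantParity

variable {g : ℕ} {τ : Fin g → ℂ} (hτ : ∀ k, 0 < (τ k).im)

/-- **The window is inhabited at every `g ≥ 2` and every intermediate index `0 < s < g`**: XI's
`exists_isRiemannForm_torusIntegral_sq_wedge_neg` fed with `θ₀ = ⊞ E_{τ_k}` and V-b's `η_s`.
[cite: Lange2023AbelianVarietiesComplex, §2.2.1 Lemma 2.2.2 and §2.4.4 Thm. 2.4.25] -/
theorem exists_isRiemannForm_torusIntegral_sq_wedge_neg_signDiag {s : ℕ} (h0 : 0 < s) (hsg : s < g)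
    (e : Fin (2 * g) ≃ Fin g × Fin 2) :
    ∃ (p : ℤ) (q : ℕ), 0 < q ∧
      IsRiemannForm (piPeriod fun k : Fin g ↦ ellipticPeriod (hτ k).ne')
        ((q : ℝ) • (piForm fun k : Fin g ↦ ellipticForm (hτ k).ne') +
          (p : ℝ) • (piForm fun k : Fin g ↦ (((if (k : ℕ) < s then -1 else 1 : ℤ)) : ℝ) • ellipticForm (hτ k).ne')) ∧
      torusIntegral (piPeriod fun k : Fin g ↦ ellipticPeriod (hτ k).ne') e
        (wedgeFamily g (mixedFamily
          (ofRealForm (-(piForm fun k : Fin g ↦ (((if (k : ℕ) < s then -1 else 1 : ℤ)) : ℝ) • ellipticForm (hτ k).ne')))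
          (ofRealForm (-((q : ℝ) • (piForm fun k : Fin g ↦ ellipticForm (hτ k).ne') +
            (p : ℝ) • (piForm fun k : Fin g ↦ (((if (k : ℕ) < s then -1 else 1 : ℤ)) : ℝ) • ellipticForm (hτ k).ne')))) g 2)) < 0 :=
  exists_isRiemannForm_torusIntegral_sq_wedge_neg _ e (IsRiemannForm.pi fun k ↦ isRiemannForm_ellipticForm (hτ k))
    (isNSForm_diag hτ _) (nondegenerate_signDiag hτ s) (by rw [hermIndex_signDiag hτ hsg.le]; exact h0)
    (by rw [hermIndex_signDiag hτ hsg.le]; exact hsg)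

end SecantParity

end Summit.Ventures.HSemireg
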